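import Literature.Analysis.FluidPDE.Tao2016AveragedNS.SeedScaleIgnition
import HarnessLib

/-!
# One-sided comparison for pseudo-orbits, and persistence of the fired state

Cell `pub-fluidc`, blueprint seat 1 (gen 13). HONEST FRAMING: low prior, high value-of-information
experiment on Tao's machine paradigm [Tao2016AveragedNS, §5.5]; NOT a claim that NS blows up.

The cell's pseudo-orbits (`IsPseudoOrbit`, CircuitShadowing.lean) are continuous on `[0,T]` and only
RIGHT-differentiable on `[0,T)`, while the seed-scale chain (SeedScaleIgnition … SeedScaleEquipartition)
is written for trajectories with a two-sided derivative everywhere, through the comparison lemmas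
`Thm53.monotoneOn_sub_of_le_deriv` / `antitoneOn_sub_of_deriv_le` / `antitoneOn_intFactor`. This
file supplies the ONE-SIDED counterparts of exactly these three lemmas (from Mathlib's
`image_le_of_deriv_right_le_deriv_boundary`), the plumbing that turns a pseudo-orbit into the
chain's hypotheses (a velocity function, coordinate and energy right-derivatives), and — as the
first ported block — the two estimates that need no mode dynamics: the energy drift
`|energy(Y t) - energy(Y 0)| ≤ 20δt` and the almost-monotone output `ã(s) - δ(t - s) ≤ ã(t)`, hence
the PERSISTENCE of a fired state: if a pseudo-orbit of a member is fired at some `t₀` (`|ã(t₀) - 1| ≤ μ`),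
it stays fired on `[t₀, T]` with `|ã - 1| ≤ μ + 7δ₀ + 21δT` and `Σ_{i≠4} Yᵢ² ≤ 2(μ + 7δ₀ + 21δT)`
(`IsPseudoOrbit.fired_persists`). With this, the cell's typed question `PseudoOrbitTransitionSeed q`
(NegativeKickSharp.lean) reduces to reaching the fired state once, by time `2`.

* `RightDeriv.antitoneOn_of_deriv_nonpos`, `monotoneOn_of_deriv_nonneg`,
  `antitoneOn_sub_of_deriv_le`, `monotoneOn_sub_of_le_deriv`, `antitoneOn_intFactor`,
  `monotoneOn_intFactor` — one-sided comparison on `[a, b]`;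
* `hasDerivWithinAt_coord`, `IsPseudoOrbit.exists_velocity`, `IsPseudoOrbit.continuousOn_coord`
  (the energy's right derivative is `hasDerivWithinAt_energy`, GlobalWellposedness.lean);
* `IsPseudoOrbit.abs_energy_sub_le`, `IsPseudoOrbit.coord_four_sub_ge`,
  `IsPseudoOrbit.fired_persists`.
-/

namespace Literature.Analysis.FluidPDE.Tao2016AveragedNS

open Real Set
open scoped NNReal

/-! ## §1. One-sided comparison lemmas on a closed interval -/

namespace RightDeriv

/-- A function continuous on `[a,b]` with non-positive right derivative on `[a,b)` is antitone on
`[a,b]`. [folklore] -/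
theorem antitoneOn_of_deriv_nonpos {g g' : ℝ → ℝ} {a b : ℝ} (hgc : ContinuousOn g (Icc a b))
    (hg : ∀ t ∈ Ico a b, HasDerivWithinAt g (g' t) (Ici t) t) (h : ∀ t ∈ Ico a b, g' t ≤ 0) :
    AntitoneOn g (Icc a b) := by
  intro x hx y hy hxy
  have hgc' : ContinuousOn g (Icc x b) := hgc.mono (Icc_subset_Icc hx.1 le_rfl)
  have key := image_le_of_deriv_right_le_deriv_boundary hgc'
    (fun t ht => hg t ⟨hx.1.trans ht.1, ht.2⟩) (B := fun _ => g x) (B' := fun _ => 0) le_rfl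
    continuousOn_const (fun t _ => hasDerivWithinAt_const t (Ici t) (g x))
    (fun t ht => h t ⟨hx.1.trans ht.1, ht.2⟩)
  exact key ⟨hxy, hy.2⟩

/-- A function continuous on `[a,b]` with non-negative right derivative on `[a,b)` is monotone on
`[a,b]`. [folklore] -/
theorem monotoneOn_of_deriv_nonneg {g g' : ℝ → ℝ} {a b : ℝ} (hgc : ContinuousOn g (Icc a b))
    (hg : ∀ t ∈ Ico a b, HasDerivWithinAt g (g' t) (Ici t) t) (h : ∀ t ∈ Ico a b, 0 ≤ g' t) :
    MonotoneOn g (Icc a b) := by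
  have := antitoneOn_of_deriv_nonpos (g := fun t => -g t) (g' := fun t => -g' t) hgc.neg
    (fun t ht => (hg t ht).neg) (fun t ht => by simpa using h t ht)
  intro x hx y hy hxy
  have := this hx hy hxy
  simpa using this

/-- Upper right-derivative bound: `f' ≤ φ = Φ'` on `[a,b)` ⇒ `f - Φ` antitone on `[a,b]`.
[folklore] -/
theorem antitoneOn_sub_of_deriv_le {f f' φ Φ : ℝ → ℝ} {a b : ℝ}
    (hfc : ContinuousOn f (Icc a b)) (hf : ∀ t ∈ Ico a b, HasDerivWithinAt f (f' t) (Ici t) t)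
    (hΦc : ContinuousOn Φ (Icc a b)) (hΦ : ∀ t ∈ Ico a b, HasDerivWithinAt Φ (φ t) (Ici t) t)
    (h : ∀ t ∈ Ico a b, f' t ≤ φ t) : AntitoneOn (fun t => f t - Φ t) (Icc a b) :=
  antitoneOn_of_deriv_nonpos (g' := fun t => f' t - φ t) (hfc.sub hΦc)
    (fun t ht => (hf t ht).sub (hΦ t ht)) (fun t ht => by linarith [h t ht])

/-- Lower right-derivative bound: `Φ' = φ ≤ f'` on `[a,b)` ⇒ `f - Φ` monotone on `[a,b]`.
[folklore] -/
theorem monotoneOn_sub_of_le_deriv {f f' φ Φ : ℝ → ℝ} {a b : ℝ}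
    (hfc : ContinuousOn f (Icc a b)) (hf : ∀ t ∈ Ico a b, HasDerivWithinAt f (f' t) (Ici t) t)
    (hΦc : ContinuousOn Φ (Icc a b)) (hΦ : ∀ t ∈ Ico a b, HasDerivWithinAt Φ (φ t) (Ici t) t)
    (h : ∀ t ∈ Ico a b, φ t ≤ f' t) : MonotoneOn (fun t => f t - Φ t) (Icc a b) :=
  monotoneOn_of_deriv_nonneg (g' := fun t => f' t - φ t) (hfc.sub hΦc)
    (fun t ht => (hf t ht).sub (hΦ t ht)) (fun t ht => by linarith [h t ht])

/-- Integrating factor, upper bound: `((f' - g f)e^{-G}) ≤ φ = Φ'` on `[a,b)` (with `G' = g`) ⇒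
`f e^{-G} - Φ` antitone on `[a,b]`. [folklore] -/
theorem antitoneOn_intFactor {f f' g G φ Φ : ℝ → ℝ} {a b : ℝ}
    (hfc : ContinuousOn f (Icc a b)) (hf : ∀ t ∈ Ico a b, HasDerivWithinAt f (f' t) (Ici t) t)
    (hGc : ContinuousOn G (Icc a b)) (hG : ∀ t ∈ Ico a b, HasDerivWithinAt G (g t) (Ici t) t)
    (hΦc : ContinuousOn Φ (Icc a b)) (hΦ : ∀ t ∈ Ico a b, HasDerivWithinAt Φ (φ t) (Ici t) t)
    (h : ∀ t ∈ Ico a b, (f' t - g t * f t) * exp (-G t) ≤ φ t) :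
    AntitoneOn (fun t => f t * exp (-G t) - Φ t) (Icc a b) := by
  have hd : ∀ t ∈ Ico a b, HasDerivWithinAt (fun t => f t * exp (-G t))
      ((f' t - g t * f t) * exp (-G t)) (Ici t) t := by
    intro t ht
    refine ((hf t ht).mul (hG t ht).neg.exp).congr_deriv ?_
    simp only [Pi.neg_apply]
    ring
  exact antitoneOn_sub_of_deriv_le (hfc.mul hGc.neg.rexp) hd hΦc hΦ h

/-- Integrating factor, lower bound: `φ = Φ' ≤ (f' - g f)e^{-G}` on `[a,b)` ⇒ `f e^{-G} - Φ`
monotone on `[a,b]`. [folklore] -/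
theorem monotoneOn_intFactor {f f' g G φ Φ : ℝ → ℝ} {a b : ℝ}
    (hfc : ContinuousOn f (Icc a b)) (hf : ∀ t ∈ Ico a b, HasDerivWithinAt f (f' t) (Ici t) t)
    (hGc : ContinuousOn G (Icc a b)) (hG : ∀ t ∈ Ico a b, HasDerivWithinAt G (g t) (Ici t) t)
    (hΦc : ContinuousOn Φ (Icc a b)) (hΦ : ∀ t ∈ Ico a b, HasDerivWithinAt Φ (φ t) (Ici t) t)
    (h : ∀ t ∈ Ico a b, φ t ≤ (f' t - g t * f t) * exp (-G t)) :
    MonotoneOn (fun t => f t * exp (-G t) - Φ t) (Icc a b) := by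
  have hd : ∀ t ∈ Ico a b, HasDerivWithinAt (fun t => f t * exp (-G t))
      ((f' t - g t * f t) * exp (-G t)) (Ici t) t := by
    intro t ht
    refine ((hf t ht).mul (hG t ht).neg.exp).congr_deriv ?_
    simp only [Pi.neg_apply]
    ring
  exact monotoneOn_sub_of_le_deriv (hfc.mul hGc.neg.rexp) hd hΦc hΦ h

end RightDeriv

/-! ## §2. Plumbing: velocity, coordinates and energy of a pseudo-orbit -/

variable {m : ℕ}

/-- Coordinates of a right derivative. [folklore] -/
theorem hasDerivWithinAt_coord {X : ℝ → Fin m → ℝ} {V : Fin m → ℝ} {s : Set ℝ} {t : ℝ}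
    (hX : HasDerivWithinAt X V s t) (i : Fin m) : HasDerivWithinAt (fun u => X u i) (V i) s t :=
  (hasDerivWithinAt_pi.1 hX) i

/-- A pseudo-orbit has a VELOCITY FUNCTION on `[0,T)` (a choice of the right derivatives).
[folklore] -/
theorem IsPseudoOrbit.exists_velocity {F : (Fin m → ℝ) → (Fin m → ℝ)} {δ : ℝ} {R : ℝ≥0} {T : ℝ}
    {Y : ℝ → Fin m → ℝ} (h : IsPseudoOrbit F δ R T Y) :
    ∃ V : ℝ → Fin m → ℝ, ∀ t ∈ Ico 0 T, HasDerivWithinAt Y (V t) (Ici t) t ∧ ‖V t - F (Y t)‖ ≤ δ := by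
  classical
  refine ⟨fun t => if ht : t ∈ Ico 0 T then Classical.choose (h.defect t ht) else 0, fun t ht => ?_⟩
  simp only [dif_pos ht]
  exact Classical.choose_spec (h.defect t ht)

/-- Coordinates of a pseudo-orbit are continuous on the window. [folklore] -/
theorem IsPseudoOrbit.continuousOn_coord {F : (Fin m → ℝ) → (Fin m → ℝ)} {δ : ℝ} {R : ℝ≥0}
    {T : ℝ} {Y : ℝ → Fin m → ℝ} (h : IsPseudoOrbit F δ R T Y) (i : Fin m) :
    ContinuousOn (fun t => Y t i) (Icc 0 T) :=
  (continuous_apply i).comp_continuousOn h.continuousOn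

/-! ## §3. The two dynamics-free estimates for pseudo-orbits of a member, and persistence -/

section Member

variable {K M ε δ T : ℝ} {Y : ℝ → Fin 5 → ℝ}

/-- **Energy drift of a pseudo-orbit**: `|energy(Y t) - energy(Y 0)| ≤ 20δt` on `[0,T]` (the
design field cancels; only the defect works; the end point by continuity).
[cite: Tao2016AveragedNS, §5 (g-cancel)] -/
theorem IsPseudoOrbit.abs_energy_sub_le (h : IsPseudoOrbit (delayCircuitWith K M ε) δ 2 T Y) {t : ℝ}
    (ht : t ∈ Icc 0 T) : |energy (Y t) - energy (Y 0)| ≤ 20 * δ * t := by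
  obtain ⟨V, hV⟩ := h.exists_velocity
  have hR : ∀ u ∈ Ico 0 T, ‖Y u‖ ≤ 2 := fun u hu => by simpa using h.norm_le u hu
  have hEc : ContinuousOn (fun u => energy (Y u)) (Icc 0 T) := by
    unfold energy
    exact continuousOn_finsetSum _ fun i _ => (h.continuousOn_coord i).pow 2
  have hd : ∀ u ∈ Ico 0 T, HasDerivWithinAt (fun s => energy (Y s)) (2 * ∑ i, V u i * Y u i)
      (Ici u) u := fun u hu => hasDerivWithinAt_energy (hV u hu).1
  have hrate : ∀ u ∈ Ico 0 T, |2 * ∑ i, V u i * Y u i| ≤ 20 * δ :=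
    fun u hu => Ignition.abs_energy_rate_le (hV u hu).2 (hR u hu)
  have hup := RightDeriv.antitoneOn_sub_of_deriv_le (f := fun s => energy (Y s))
    (φ := fun _ => 20 * δ) (Φ := fun u => 20 * δ * u) hEc hd
    (continuousOn_const.mul continuousOn_id)
    (fun u _ => by simpa using ((hasDerivAt_id u).const_mul (20 * δ)).hasDerivWithinAt)
    (fun u hu => (abs_le.1 (hrate u hu)).2)
  have hlo := RightDeriv.monotoneOn_sub_of_le_deriv (f := fun s => energy (Y s))
    (φ := fun _ => -(20 * δ)) (Φ := fun u => -(20 * δ) * u) hEc hd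
    (continuousOn_const.mul continuousOn_id)
    (fun u _ => by simpa using ((hasDerivAt_id u).const_mul (-(20 * δ))).hasDerivWithinAt)
    (fun u hu => (abs_le.1 (hrate u hu)).1)
  have h0 : (0 : ℝ) ∈ Icc 0 T := ⟨le_rfl, ht.1.trans ht.2⟩
  have h1 := hup h0 ht ht.1
  have h2 := hlo h0 ht ht.1
  simp only [mul_zero, sub_zero] at h1 h2
  rw [abs_le]; constructor <;> linarith

/-- **Almost-monotone output of a pseudo-orbit**: `ã(s) - δ(t - s) ≤ ã(t)` for `0 ≤ s ≤ t ≤ T`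
(`∂ₜ⁺ã = Kd² + θ₄ ≥ -δ`). [cite: Tao2016AveragedNS, §5.5 (5.5)] -/
theorem IsPseudoOrbit.coord_four_sub_ge (h : IsPseudoOrbit (delayCircuitWith K M ε) δ 2 T Y)
    (hK : 0 ≤ K) {s t : ℝ} (hs : 0 ≤ s) (hst : s ≤ t) (ht : t ≤ T) :
    Y s 4 - δ * (t - s) ≤ Y t 4 := by
  obtain ⟨V, hV⟩ := h.exists_velocity
  have hmono := RightDeriv.monotoneOn_sub_of_le_deriv (a := 0) (b := T) (f := fun u => Y u 4)
    (φ := fun _ => -δ) (Φ := fun u => -δ * u) (h.continuousOn_coord 4)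
    (fun u hu => hasDerivWithinAt_coord (hV u hu).1 4) (continuousOn_const.mul continuousOn_id)
    (fun u _ => by simpa using ((hasDerivAt_id u).const_mul (-δ)).hasDerivWithinAt)
    (fun u hu => by
      have hθ := (abs_le.1 (abs_coord_defect_le (hV u hu).2 4)).1
      rw [Ignition.field_four] at hθ
      have : 0 ≤ K * Y u 3 ^ 2 := by positivity
      show -δ ≤ V u 4
      linarith)
  have := hmono ⟨hs, hst.trans ht⟩ ⟨hs.trans hst, ht⟩ hst
  have hring : δ * (t - s) = δ * t - δ * s := by ring
  simp only at this
  linarith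

/-- **Persistence of the fired state along a pseudo-orbit.** Let `Y` be a `δ`-pseudo-orbit
(`δ ≥ 0`) of a member `delayCircuitWith K M ε` (`K ≥ 0`) in the sup-ball of radius `2` on `[0,T]`,
issued `δ₀`-close to Tao's datum (5.6) (`δ₀ ≤ 1`), and suppose it is FIRED at some `t₀ ∈ [0,T]`:
`|ã(t₀) - 1| ≤ μ`. If `ν := μ + 7δ₀ + 21δT ≤ 1`, then on `[t₀, T]`: `|ã - 1| ≤ ν` and `Yᵢ² ≤ 2ν`
for the four other modes. No mode dynamics is used: the output is almost monotone and the energy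
almost conserved (`energy ≤ 1 + 7δ₀ + 20δT`), so the other modes carry at most `energy - ã²`.
[cite: Tao2016AveragedNS, §5.5 Theorem 5.3, (able), (energy-con)] -/
theorem IsPseudoOrbit.fired_persists {δ₀ : ℝ} (h : IsPseudoOrbit (delayCircuitWith K M ε) δ 2 T Y)
    (hK : 0 ≤ K) (hδ : 0 ≤ δ) (h0 : ‖Y 0 - delayInit‖ ≤ δ₀) (hδ₀ : δ₀ ≤ 1) {t₀ μ : ℝ}
    (ht₀ : t₀ ∈ Icc 0 T) (hμ : |Y t₀ 4 - 1| ≤ μ) (hν : μ + 7 * δ₀ + 21 * δ * T ≤ 1) :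
    ∀ t ∈ Icc t₀ T, |Y t 4 - 1| ≤ μ + 7 * δ₀ + 21 * δ * T ∧
      ∀ i : Fin 5, i ≠ 4 → Y t i ^ 2 ≤ 2 * (μ + 7 * δ₀ + 21 * δ * T) := by
  intro t ht
  have hT0 : 0 ≤ T := ht₀.1.trans ht₀.2
  have ht0T : t ∈ Icc 0 T := ⟨ht₀.1.trans ht.1, ht.2⟩
  have hδ₀0 : 0 ≤ δ₀ := (norm_nonneg _).trans h0
  have hδT : 0 ≤ δ * T := mul_nonneg hδ hT0
  -- almost-monotone output
  have hmono := h.coord_four_sub_ge hK ht₀.1 ht.1 ht.2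
  have hδt : δ * (t - t₀) ≤ δ * T := mul_le_mul_of_nonneg_left (by linarith [ht.2, ht₀.1]) hδ
  have hlo : 1 - μ - δ * T ≤ Y t 4 := by linarith [(abs_le.1 hμ).1]
  -- almost-conserved energy
  have hE := h.abs_energy_sub_le ht0T
  have hE0 := Ignition.abs_energy_init_le h0 hδ₀
  have h20 : 20 * δ * t ≤ 20 * δ * T := mul_le_mul_of_nonneg_left ht.2 (by positivity)
  have hEt : energy (Y t) ≤ 1 + 7 * δ₀ + 20 * δ * T := by
    linarith [(abs_le.1 hE).2, (abs_le.1 hE0).2]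
  have he_sq := Ignition.sq_le_energy (Y t) 4
  have hhi : Y t 4 - 1 ≤ 7 * δ₀ + 20 * δ * T := by
    by_cases h1 : 1 ≤ Y t 4
    · have hid : (Y t 4 - 1) * (Y t 4 + 1) = Y t 4 ^ 2 - 1 := by ring
      have hprod : (Y t 4 - 1) * (Y t 4 + 1) ≤ 7 * δ₀ + 20 * δ * T := by rw [hid]; linarith
      calc Y t 4 - 1 = (Y t 4 - 1) * 1 := by ring
        _ ≤ (Y t 4 - 1) * (Y t 4 + 1) := mul_le_mul_of_nonneg_left (by linarith) (by linarith)
        _ ≤ 7 * δ₀ + 20 * δ * T := hprod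
    · linarith
  have hμ0 : 0 ≤ μ := (abs_nonneg _).trans hμ
  refine ⟨by rw [abs_le]; constructor <;> linarith, fun i hi => ?_⟩
  -- the other modes carry at most `energy - ã²`
  have hsum := sq_le_residual (Y t) hi
  have h5 := Ignition.energy_five (Y t)
  have hμ0 : 0 ≤ 1 - μ - δ * T := by linarith
  have hesq : (1 - μ - δ * T) ^ 2 ≤ Y t 4 ^ 2 := pow_le_pow_left₀ hμ0 hlo 2
  have hexp2 : 1 - 2 * (μ + δ * T) ≤ (1 - μ - δ * T) ^ 2 := by nlinarith [sq_nonneg (μ + δ * T)]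
  linarith

end Member

end Literature.Analysis.FluidPDE.Tao2016AveragedNS
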